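import Summits.Ventures.WeilGRH.UniformConductorFloorPrincipal
import Summits.Ventures.WeilGRH.UniformConductorFloorJointFloors
import HarnessLib

/-!
# GRH arm (rh-explicit, venture WeilGRH): Weil positivity on `[-1, 1]` for ALL characters of a PRIME modulus — the exact
  dichotomy `p ≥ 79`

Cell `rh-explicit`, WEIL TRACK — GRH ARM (weil-grh-1, gen8).  Assembly of the two sides of the arm's uniform `t = 1` statement
«`U(q)`: every Dirichlet character `χ` mod `q` satisfies `WeilPositivityOnChar χ 1`» (Weil's hermitian form of `L(s, χ)`
non-negative on every smooth test function supported in `[-1, 1]`) for PRIME moduli: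

* POSITIVE side (gen6; `UniformConductorFloorJointFloors.weilPositivityOnChar_one_of_ge_78`): `U(q)` for every `q ≥ 78`
  (the joint cell certificate of the all-trivial key; exact pseudo-key floor `75`);
* NEGATIVE side (gen8; `UniformConductorFloorPrincipal.not_weilPositivityOnChar_one_principal_of_prime_le`): the PRINCIPAL
  character mod `p` fails for every prime `p ≤ 73` (flat-window witness: `log p < F₀(1) = 4.2913… = log 73.06…`, the Gram entry
  `twistedGramCoeff 1 1 0 0` kernel-evaluated on the `ζ` lane's table).

**THEOREM (`forall_weilPositivityOnChar_one_iff_of_prime`).**  For a PRIME `p`:  `U(p) ↔ 79 ≤ p`  — there is no prime in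
`(73.06, 78)`, so the two certified sides meet with nothing in between.  Equivalently
(`exists_not_weilPositivityOnChar_one_iff_of_prime`): a prime modulus carries a character failing Weil positivity on `[-1, 1]`
iff `p ≤ 73`, and then the principal character is one.  The all-moduli decision (every `q ≥ 2` outside a short explicit list)
is assembled separately once the level-`5`/`7` divisibility floors close `65` and `77`
(`UniformConductorFloorCoprimeRemainder.lean` gives `U(q)` for every `q ∉ R₀` already; `UniformConductorFloorPrincipal.lean` refutes
it on `R₀ ∖ {0, 1, 18, 32, 65, 77}`).

Reading: at the window `t = 1` the obstruction to the all-characters statement below the threshold is always the principal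
character (no polar term), never a character `L`-function; the threshold for primes is the sharp integer `79`.  Nothing here
bears on GRH for any individual character; RH/GRH-free; standard axioms.

## References

* A. Weil, *Sur les "formules explicites" de la théorie des nombres premiers* (1952), (11) pp. 261–262 and the «lemme»
  p. 262. [Weil1952FormulesExplicites]
* H. Yoshida, *On Hermitian forms attached to zeta functions*, Adv. Stud. Pure Math. 21 (1992) 281–325, §5 (5.15).
  [Yoshida1992HermitianForms]
-/

set_option autoImplicit false

noncomputable section

namespace Summit.Ventures.WeilGRH

open Literature.NumberTheory.LFunctions

namespace UniformFloor

variable {q : ℕ}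

/-- ★★ **PRIME MODULI: the exact dichotomy.**  For a prime `p`, every Dirichlet character mod `p` is Weil-positive on
`[-1, 1]` if and only if `p ≥ 79`. [cite: Weil1952FormulesExplicites, (11) pp. 261–262 and the «lemme» p. 262] -/
theorem forall_weilPositivityOnChar_one_iff_of_prime (hp : q.Prime) :
    (∀ χ : DirichletCharacter ℂ q, WeilPositivityOnChar χ 1) ↔ 79 ≤ q := by
  constructor
  · intro h
    by_contra hlt
    have h73 : q ≤ 73 := by
      by_contra h'
      have h74 : 74 ≤ q := by omega
      have h78 : q ≤ 78 := by omega
      interval_cases q <;> exact absurd hp (by norm_num)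
    exact not_weilPositivityOnChar_one_principal_of_prime_le hp h73 (h 1)
  · intro h79 χ
    exact weilPositivityOnChar_one_of_ge_78 (by omega) χ

/-- **Below `79` a prime modulus always carries a failing character** (the principal one); above, none.
[cite: Weil1952FormulesExplicites, (11) pp. 261–262] -/
theorem exists_not_weilPositivityOnChar_one_iff_of_prime (hp : q.Prime) :
    (∃ χ : DirichletCharacter ℂ q, ¬ WeilPositivityOnChar χ 1) ↔ q ≤ 73 := by
  have h := forall_weilPositivityOnChar_one_iff_of_prime hp
  constructor
  · rintro ⟨χ, hχ⟩
    by_contra h73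
    have h79 : 79 ≤ q := by
      by_contra h'
      have h74 : 74 ≤ q := by omega
      have h78 : q ≤ 78 := by omega
      interval_cases q <;> exact absurd hp (by norm_num)
    exact hχ (h.2 h79 χ)
  · intro h73
    exact ⟨1, not_weilPositivityOnChar_one_principal_of_prime_le hp h73⟩

/-- … and `73` is sharp: some character mod `73` fails. [cite: Weil1952FormulesExplicites, (11) pp. 261–262] -/
theorem exists_not_weilPositivityOnChar_one_seventyThree :
    ∃ χ : DirichletCharacter ℂ 73, ¬ WeilPositivityOnChar χ 1 :=
  ⟨1, not_weilPositivityOnChar_one_principal_of_prime_le (by norm_num) (by norm_num)⟩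

end UniformFloor

end Summit.Ventures.WeilGRH

end
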